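import Summits.ValiantsHypothesis.ValiantsHypothesis.Theorems.DepthWindowJumpFactorOps
import Summits.ValiantsHypothesis.ValiantsHypothesis.Theorems.DepthWindowPathWeights
import Mathlib.Logic.Equiv.Fin.Basic
import HarnessLib

/-!
# Route `DepthWindow`, g8 — the leaf operand tables of the two-level jump formula

Piece (iv) of the `(2,3)` SLIVER LEMMA (lens-4 NODE-v8 §11–§12), leaf side assembled: for a block
`q` of an outer index with jump count `κ` and an inner path `s`, the FLATTENED table
`leafOp … q s : Fin (b·(t+1)) → Operand` (slot `(u, l)` = the `l`-th factor of the `u`-th layer entry,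
a `jumpFactorOp` or an `idFactorOp`) has product of values equal to the path weight of `s` through
the padded jump layers (`prod_leafOp_eval`), hence weighted homogeneous of weight
`(s_b)₁ - (s₀)₁` (`prod_leafOp_isWeightedHomogeneous`); references and depths are those of the
component operands (`leafOp_refsBelow`, `leafOp_depthIn`).  The terminal table `finFactorOp` has
product `finVec` (`prod_finFactorOp_eval`), of weight `0`.  These are exactly the `leaf` / `extra`
hypotheses of `exists_append_sumProdSumProdMul`.  Pure bookkeeping; nothing here bears on `VP ≠ VNP`.

[cite: LimayeSrinivasanTavenas2025, Lemma 11] [cite: Burgisser2000, Def. 2.1]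
-/

set_option linter.dupNamespace false

namespace Summit.ValiantsHypothesis.ValiantsHypothesis.Theorems.DepthWindow

open Finset MvPolynomial Literature.Computability.AlgebraicComplexity ArithCircuit

variable {k : Type*} [CommRing k] {τ : Type*}

/-- The flattened leaf operand table of block `q` (jump count `κ`, inner path `s`): slot `(u, l)`
(flattened by `finProdFinEquiv`) is factor `l` of layer `q·b + u` between `s_u` and `s_{u+1}`. -/
def leafOp (d t : ℕ) (cmp : ℕ → ℕ → Operand k τ) (κ a b : ℕ) (q : Fin a)
    (s : Fin (b + 1) → Fin (d + 1) × Fin (t + 1)) (u' : Fin (b * (t + 1))) : Operand k τ :=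
  if (q : ℕ) * b + ((finProdFinEquiv.symm u').1 : ℕ) < κ then
    jumpFactorOp d t cmp (s (finProdFinEquiv.symm u').1.castSucc) (s (finProdFinEquiv.symm u').1.succ)
      (finProdFinEquiv.symm u').2
  else
    idFactorOp d t (s (finProdFinEquiv.symm u').1.castSucc) (s (finProdFinEquiv.symm u').1.succ)
      (finProdFinEquiv.symm u').2

section Semantics

variable (w : τ → ℕ) (d t : ℕ) (U : ℕ → MvPolynomial τ k) (cmp : ℕ → ℕ → Operand k τ)
  (V : List (MvPolynomial τ k)) (D : List ℕ) (n D₀ : ℕ)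

/-- **Product of the leaf values = the path weight through the padded jump layers.** -/
theorem prod_leafOp_eval
    (hev : ∀ l ε, l < t → ε ≤ d → (cmp l ε).eval V = weightedHomogeneousComponent w ε (U l))
    (κ a b : ℕ) (q : Fin a) (s : Fin (b + 1) → Fin (d + 1) × Fin (t + 1)) :
    ∏ u' : Fin (b * (t + 1)), (leafOp d t cmp κ a b q s u').eval V =
      pathWeight (fun u : Fin b =>
        padLayers (jumpMat w d t U) κ (a * b) ⟨(q : ℕ) * b + u, blockIndex_lt q u⟩) s := by
  unfold pathWeight
  rw [← Fintype.prod_equiv finProdFinEquiv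
      (fun p : Fin b × Fin (t + 1) => (leafOp d t cmp κ a b q s (finProdFinEquiv p)).eval V)
      (fun u' => (leafOp d t cmp κ a b q s u').eval V) (fun _ => rfl),
    Fintype.prod_prod_type]
  refine Fintype.prod_congr _ _ fun u => ?_
  show ∏ l : Fin (t + 1), (leafOp d t cmp κ a b q s (finProdFinEquiv (u, l))).eval V =
    padLayers (jumpMat w d t U) κ (a * b) ⟨(q : ℕ) * b + u, blockIndex_lt q u⟩ (s u.castSucc) (s u.succ)
  rw [padLayers_jumpMat_apply_eq_prod]
  refine Fintype.prod_congr _ _ fun l => ?_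
  unfold leafOp
  rw [Equiv.symm_apply_apply]
  have hc : (((⟨(q : ℕ) * b + u, blockIndex_lt q u⟩ : Fin (a * b)) : ℕ) < κ) ↔
      (q : ℕ) * b + (u : ℕ) < κ := Iff.rfl
  by_cases h : (q : ℕ) * b + (u : ℕ) < κ
  · rw [if_pos h, if_pos (hc.mpr h)]
    exact eval_jumpFactorOp w d t U cmp V hev _ _ _
  · rw [if_neg h, if_neg (fun h' => h (hc.mp h'))]
    exact eval_idFactorOp d t V _ _ _

/-- The leaf product is weighted homogeneous of weight `(s_b)₁ - (s₀)₁`. -/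
theorem prod_leafOp_isWeightedHomogeneous
    (hev : ∀ l ε, l < t → ε ≤ d → (cmp l ε).eval V = weightedHomogeneousComponent w ε (U l))
    (κ a b : ℕ) (q : Fin a) (s : Fin (b + 1) → Fin (d + 1) × Fin (t + 1)) :
    IsWeightedHomogeneous w (∏ u' : Fin (b * (t + 1)), (leafOp d t cmp κ a b q s u').eval V)
      (((s (Fin.last b)).1 : ℕ) - (s 0).1) := by
  rw [prod_leafOp_eval w d t U cmp V hev]
  exact pathWeight_padLayers_isWeightedHomogeneous w d t U κ a b q s

/-- **Product of the terminal factor values = `finVec`.** -/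
theorem prod_finFactorOp_eval (e : ℕ)
    (hev : ∀ l ε, l < t → ε ≤ d → (cmp l ε).eval V = weightedHomogeneousComponent w ε (U l))
    (y : Fin (d + 1) × Fin (t + 1)) :
    ∏ v : Fin (t + 1), (finFactorOp d t e cmp y v).eval V = finVec w d t e U y := by
  rw [finVec_eq_prod_finFactor]
  exact Fintype.prod_congr _ _ fun v => eval_finFactorOp w d t U cmp V e hev y v

/-- `finVec` is weighted homogeneous of weight `0`. -/
theorem finVec_isWeightedHomogeneous (e : ℕ) (y : Fin (d + 1) × Fin (t + 1)) :
    IsWeightedHomogeneous w (finVec w d t e U y) 0 := by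
  unfold finVec
  by_cases hy : (y.1 : ℕ) = e
  · rw [if_pos hy]
    have h := IsWeightedHomogeneous.prod (Ico (y.2 : ℕ) t)
      (fun l => weightedHomogeneousComponent w 0 (U l)) (fun _ => 0)
      fun l _ => weightedHomogeneousComponent_isWeightedHomogeneous 0 (U l)
    rwa [Finset.sum_const_zero] at h
  · rw [if_neg hy]
    exact isWeightedHomogeneous_zero k w 0

/-- The terminal product is weighted homogeneous of weight `0`. -/
theorem prod_finFactorOp_isWeightedHomogeneous (e : ℕ)
    (hev : ∀ l ε, l < t → ε ≤ d → (cmp l ε).eval V = weightedHomogeneousComponent w ε (U l))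
    (y : Fin (d + 1) × Fin (t + 1)) :
    IsWeightedHomogeneous w (∏ v : Fin (t + 1), (finFactorOp d t e cmp y v).eval V) 0 := by
  rw [prod_finFactorOp_eval w d t U cmp V e hev y]
  exact finVec_isWeightedHomogeneous w d t U e y

/-- References of the leaf operands. -/
theorem leafOp_refsBelow (hrefs : ∀ l ε, l < t → ε ≤ d → (cmp l ε).RefsBelow n)
    (κ a b : ℕ) (q : Fin a) (s : Fin (b + 1) → Fin (d + 1) × Fin (t + 1))
    (u' : Fin (b * (t + 1))) : (leafOp d t cmp κ a b q s u').RefsBelow n := by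
  unfold leafOp
  by_cases h : (q : ℕ) * b + ((finProdFinEquiv.symm u').1 : ℕ) < κ
  · rw [if_pos h]; exact jumpFactorOp_refsBelow d t cmp n hrefs _ _ _
  · rw [if_neg h]; exact idFactorOp_refsBelow d t n _ _ _

/-- Depth of the leaf operands. -/
theorem leafOp_depthIn (hdp : ∀ l ε, l < t → ε ≤ d → (cmp l ε).depthIn D ≤ D₀)
    (κ a b : ℕ) (q : Fin a) (s : Fin (b + 1) → Fin (d + 1) × Fin (t + 1))
    (u' : Fin (b * (t + 1))) : (leafOp d t cmp κ a b q s u').depthIn D ≤ D₀ := by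
  unfold leafOp
  by_cases h : (q : ℕ) * b + ((finProdFinEquiv.symm u').1 : ℕ) < κ
  · rw [if_pos h]; exact jumpFactorOp_depthIn d t cmp D D₀ hdp _ _ _
  · rw [if_neg h, idFactorOp_depthIn d t D]; exact Nat.zero_le _

end Semantics

end Summit.ValiantsHypothesis.ValiantsHypothesis.Theorems.DepthWindow
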